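import Mathlib.NumberTheory.NumberField.ClassNumber
import HarnessLib

set_option linter.dupNamespace false -- `Summit.BirchSwinnertonDyer.BirchSwinnertonDyer.Theorems.…` (summit = sub)
set_option autoImplicit false

/-!
# Crux `HeegnerTwistCouplingInSupply` (stmt-BirchSwinnertonDyer-21381), line `size-tail` v3: stub `stub_ltIndivisible`
# — the SHARP size lever «h(K′) < p ⇒ p ∤ h(K′)» — PROVED (trivial)

Route `BiquadraticEisensteinDescent` (cell `pub/bsd-wall`, row-12 line lead `bsd-line-ibd-p1` g0). Skeleton of record
`size_tail` v3 (tree `Cruxes/HeegnerTwistCouplingInSupply/Lines/size_tail.lean`): the BULK/TAIL case split is now on the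
CLASS NUMBER of the Heegner field itself (`h(K′) < p`, lever (L-A) of PRESEARCH-21381 v1.1; met by 51/72 CORE census pairs
on a recorded Heegner field, KS-INSTANCE-TABLE-21381-g11) instead of the Minkowski proxy `121·|d_K′| < p` of v1/v2
(vacuous for every `p < 847`). This file proves the bulk stub: a number field with `h(K) < p` has `p ∤ h(K)` because
`0 < h(K)`. THEOREMS ONLY; no `Theses` import; nothing about the crux's tail (the coupling) or any case of BSD is asserted.
Supports stmt-BirchSwinnertonDyer-21381 (proves the registered stub by name and signature).
-/

namespace Summit.BirchSwinnertonDyer.BirchSwinnertonDyer.Theorems.BiquadraticEisensteinDescentHeegnerTwistCouplingInSupplyLtIndivisible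

/-- **Stub `stub_ltIndivisible` of line `size-tail` v3 (PROVED).** For a natural number `p` and a number field `K` with
`h(K) < p`: `p ∤ h(K)` — since `h(K) ≥ 1` (the class group is a nonempty finite group), a divisor `p` of `h(K)` would
satisfy `p ≤ h(K)`. [folklore] -/
theorem stub_ltIndivisible :
    ∀ (p : ℕ) (K : Type) [Field K] [NumberField K],
      NumberField.classNumber K < p → ¬ p ∣ NumberField.classNumber K := by
  intro p K _ _ hlt hdvd
  have hpos : 0 < NumberField.classNumber K := Fintype.card_pos
  exact absurd (Nat.le_of_dvd hpos hdvd) (by omega)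

end Summit.BirchSwinnertonDyer.BirchSwinnertonDyer.Theorems.BiquadraticEisensteinDescentHeegnerTwistCouplingInSupplyLtIndivisible
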